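import Summits.QuantumFields.BalabanUV.Beta.GAN24.DirichletBoxPairingBound
import Summits.QuantumFields.BalabanUV.Beta.GAN24.DirichletBoxCompression
import Summits.QuantumFields.BalabanUV.Beta.GAN24.DirichletBoxTraceSum

/-!
# `BalabanUV.Beta.GAN24.DirichletBoxTwoLevelCore` — binder row G-an2-4 / (CONV-C), road P2 PART II, module M-E (file 1): THE
# PER-DIRECTION ESTIMATE of the two-level pairing for two ZERO-EXTENDED fields on a block region — interior second differences and
# boundary traces (unit b2b-balaban-gan24-p2, gen 22, v1)

HONEST FRAMING (cell contract, verbatim): «discharging `BetaPertH` makes Bałaban's UV stability UNCONDITIONAL — a real constructive-QFT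
result; it is NOT the continuum limit and NOT the Clay problem.»  SUPPLIER item «Δ1-BOX-SCALAR» under the T⁴-DAG sub-row
`T4-U1a.S-NE2-D1-DIRICHLET°` (holder: the t4-ne2-p1 lineage, wall `hinj`; owner ruling R20 (c), journal l.13903), memo
`HOME/b2b-balaban-gan24-p2/gen22/DIRICHLET-BOX-TWOLEVEL.md` steps L3–L4.  With `Ω = blockReg N S` (a union of unit blocks of the coarse
torus `T = (ℤ/NM)^d`) and `Ω′ = par⁻¹Ω` (= `blockReg (RN) S` on `T′ = (ℤ/RNM)^d`), for `u` vanishing off `Ω` and `v` vanishing off `Ω′`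
the pointwise window formula of module M-P, `((A_μ − F_μ)v)(y) = cWin·Σ_{window(y,μ)} w_n (∂′_μᴴ∂′_μ v)(site)`, is split by
`𝟙_{Ω′}(site) + 𝟙_{¬Ω′}(site)`:

 * §1 window sites: `site y j m = R·y + j + m·e_μ` has block parent `y` (`m < R`) resp. `y + e_μ` (`R ≤ m < 2R`); so if `y, y + e_μ ∈ Ω`
   every window site is in `Ω′`, and `Ω′ = blockReg (RN) S` pointwise (`ScalarPlantingDefect.blockOf_par`).
 * §2 **`window_cs`** (the Cauchy–Schwarz of module M-P for an arbitrary density `g`):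
   `Σ_y ‖cWin·Σ_{j,n} w_n g(site)‖·‖b y‖ ≤ (2/N)·√nsq(g)·√nsq(b)`.
 * §3 INTERIOR part: `g = 𝟙_{Ω′}·∂′ᴴ∂′v` ⟹ `≤ (2/N)·√(H′_μ(v))·√nsq(∂_μu)`, `H′_μ(v) = Σ_{x∈Ω′}|(∂′_μᴴ∂′_μv)(x)|²`.
 * §4 EXTERIOR part: the exterior window density pairs only with BOUNDARY differences of `u` (if `y, y+e_μ ∈ Ω` the exterior density of the
   window vanishes; if both are outside, `(∂_μu)(y) = 0`); off `Ω′`, `(∂′ᴴ∂′v)(x) = −|RN|²(v(x+e_μ) + v(x−e_μ))` carries only boundary values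
   of `v`; the two summed TRACE bounds of module M-T (`trace_fwd_sum_le` / `trace_bwd_sum_le`, at both levels) then give
   `≤ (8√(2R)/N)·√(D_μ(u) + H_μ(u))·√(D′_μ(v) + H′_μ(v))`.
 * §5 **`pairing_dir_le`**: `|⟨(A_μ − F_μ)v, ∂_μu⟩| ≤ ((2 + 8√(2R))/N)·√(D_μ + H_μ)(u)·√(D′_μ + H′_μ)(v)`.
   The factor `√R` in the exterior constant is the price of NOT aligning exterior window sites with their faces (a face-by-face Cauchy–Schwarz
   removes it; recorded as an improvement, not needed for the rate).

ABSOLUTE RULE (cell, verbatim): «No internally-minted statement may enter as a cited fact. Every hypothesis is either kernel-proved in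
this package or a verbatim quotation of a PUBLISHED theorem with page reference. The manuscript(s) under audit are NOT citable for
their own disputed steps — they are the thing under adjudication; programme-internal (2001/route/tribunal) claims are never citable.»
[folklore] finite lattice calculus; nothing printed is a hypothesis.  NOT CLAIMED: NE2, (CONV-C) as a whole, `BetaPertH`, continuum, Clay;
«not in print; our proof attempt».  HONEST DEPENDENCY: continuum YM on T⁴ ⇐ BetaPertH ∧ nine spine estimates (0/9 proved); BetaPertH ⇐
(D1) ∧ (D4) ∧ CAP+tail; G-an2-4 gates asym, D1 and NE2/3/4.
-/

noncomputable section

open scoped BigOperators ComplexConjugate Matrix Matrix.Norms.L2Operator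
open Finset Polynomial

namespace Summit.QuantumFields.BalabanUV.Beta.GAN24.DirichletBoxTwoLevelCore

open Literature.MathematicalPhysics.QuantumFieldTheory.Balaban1983to89.B5Prop11Plancherel (Tor fine unitVec)
open Literature.MathematicalPhysics.QuantumFieldTheory.Balaban1983to89.B5Action121 (shiftS sdiff LapS shiftS_mulVec sdiff_mulVec
  star_mulVec_dotProduct dotProduct_mulVec_eq_star_conjTranspose_mulVec)
open Literature.MathematicalPhysics.QuantumFieldTheory.Balaban1983to89.B5Prop11Lower (nsq nsq_nonneg star_dotProduct_self
  norm_star_dotProduct_le)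
open Literature.MathematicalPhysics.QuantumFieldTheory.Balaban1983to89.B5Block118 (tstep tstep_zero tstep_succ)
open Literature.MathematicalPhysics.QuantumFieldTheory.Balaban1983to89.B5G183RateTorus (cpt)
open Literature.MathematicalPhysics.QuantumFieldTheory.Balaban1983to89.B5G183RateTorusW (off)
open Literature.MathematicalPhysics.QuantumFieldTheory.Balaban1983to89.B5Blocks16 (blockOf)
open Summit.QuantumFields.BalabanUV.T4Continuum
open Summit.QuantumFields.BalabanUV.T4Continuum.BalabanAveragedTowerModes (par rem par_cpt_add_off rem_cpt_add_off val_cpt_add_off)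
open Summit.QuantumFields.BalabanUV.T4Continuum.ScalarMassTower (cpt_add_unitVec)
open Summit.QuantumFields.BalabanUV.T4Continuum.ScalarBlockPlanting (Qavg0 JK0)
open Summit.QuantumFields.BalabanUV.T4Continuum.ScalarPlantingDefect (blockOf_par)
open Summit.QuantumFields.BalabanUV.T4Continuum.VectorBlockTrialForm (tstep_add)
open Summit.QuantumFields.BalabanUV.Beta.GAN24.DirichletBoxRegularity (Pdir Pdir_mulVec)
open Summit.QuantumFields.BalabanUV.Beta.GAN24.DirichletBoxWindowPoly (wpoly norm_coeff_wpoly_le)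
open Summit.QuantumFields.BalabanUV.Beta.GAN24.DirichletBoxPairing
open Summit.QuantumFields.BalabanUV.Beta.GAN24.DirichletBoxCompression (refineR)
open Summit.QuantumFields.BalabanUV.Beta.GAN24.DirichletBoxTrace (blockReg trace_fwd_sum_le trace_bwd_sum_le)

variable {d : ℕ} (N R : ℕ) [NeZero N] [NeZero R] (M : Fin d → ℕ) [hM : ∀ μ, NeZero (M μ)]

/-! ## §1 Window sites and regions -/

/-- the window site `R·y + j + m·e_μ` of the coarse site `y` (offset `j`, `m` fine steps along `μ`). [folklore] -/
def site (μ : Fin d) (y : Tor (fine N M)) (j : Fin d → Fin R) (m : ℕ) : Tor (fine (R * N) M) :=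
  cpt N R M y + off N R M j + tstep (fine (R * N) M) μ m

/-- parent of a window site in the first cell: `par(R·y + j + m·e_μ) = y` for `m < R`, `j_μ = 0`. [folklore] -/
theorem par_site_lt (μ : Fin d) (y : Tor (fine N M)) {j : Fin d → Fin R} (hj : (j μ : ℕ) = 0) {m : ℕ} (hm : m < R) :
    par N R M (site N R M μ y j m) = y := by
  rw [site, add_assoc, off_add_tstep_eq N R M μ hj ⟨m, hm⟩, par_cpt_add_off]

/-- parent of a window site in the second cell: `par(R·y + j + m·e_μ) = y + e_μ` for `R ≤ m < 2R`, `j_μ = 0`. [folklore] -/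
theorem par_site_ge (μ : Fin d) (y : Tor (fine N M)) {j : Fin d → Fin R} (hj : (j μ : ℕ) = 0) {m : ℕ} (hm : R ≤ m) (hm2 : m < 2 * R) :
    par N R M (site N R M μ y j m) = y + unitVec (fine N M) μ := by
  have e : m = R + (m - R) := by omega
  rw [site, e, tstep_add, ← add_assoc, add_right_comm (cpt N R M y) (off N R M j), ← cpt_add_unitVec, add_assoc,
    off_add_tstep_eq N R M μ hj ⟨m - R, by omega⟩, par_cpt_add_off]

variable (Ω : Tor (fine N M) → Prop) [DecidablePred Ω]

omit [DecidablePred Ω] in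
/-- if both cells are inside, every window site is in `Ω′`. [folklore] -/
theorem refineR_site (μ : Fin d) {y : Tor (fine N M)} (hy : Ω y) (hy' : Ω (y + unitVec (fine N M) μ)) {j : Fin d → Fin R}
    (hj : (j μ : ℕ) = 0) {m : ℕ} (hm2 : m < 2 * R) : refineR N R M Ω (site N R M μ y j m) := by
  show Ω (par N R M (site N R M μ y j m))
  rcases Nat.lt_or_ge m R with h | h
  · rw [par_site_lt N R M μ y hj h]; exact hy
  · rw [par_site_ge N R M μ y hj h hm2]; exact hy'

section BlockRegion

variable (S : Tor M → Prop) [DecidablePred S]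

omit [DecidablePred S] in
/-- the refined block region is the block region of the finer torus: `Ω′ = par⁻¹(blockReg_N S) = blockReg_{RN} S` pointwise. [folklore] -/
theorem refineR_blockReg_iff (x : Tor (fine (R * N) M)) : refineR N R M (blockReg N M S) x ↔ blockReg (R * N) M S x := by
  show S (blockOf N M (par N R M x)) ↔ S (blockOf (R * N) M x)
  rw [blockOf_par]

end BlockRegion

/-! ## §2 The window Cauchy–Schwarz for an arbitrary density -/

/-- the weighted window sum of a density `g` at the coarse site `y`. [folklore] -/
def winSum (μ : Fin d) (g : Tor (fine (R * N) M) → ℂ) (y : Tor (fine N M)) : ℂ :=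
  ∑ j ∈ univ.filter (fun j : Fin d → Fin R => (j μ : ℕ) = 0), ∑ n ∈ range (2 * R - 2), (wpoly R).coeff n * g (site N R M μ y j (n + 1))

omit hM in
/-- pointwise: `‖cWin·winSum g y‖ ≤ (N√(R^d))⁻¹·Σ_{window} ‖g‖`. [folklore] -/
theorem norm_cWin_winSum_le (μ : Fin d) (g : Tor (fine (R * N) M) → ℂ) (y : Tor (fine N M)) :
    ‖cWin d N R * winSum N R M μ g y‖
      ≤ ((N : ℝ) * Real.sqrt ((R : ℝ) ^ d))⁻¹ *
          ∑ j ∈ univ.filter (fun j : Fin d → Fin R => (j μ : ℕ) = 0), ∑ n ∈ range (2 * R - 2), ‖g (site N R M μ y j (n + 1))‖ := by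
  rw [norm_mul, ← norm_cWin_mul_sq N R, mul_assoc]
  refine mul_le_mul_of_nonneg_left ?_ (norm_nonneg _)
  rw [winSum, Finset.mul_sum]
  refine (norm_sum_le _ _).trans (Finset.sum_le_sum fun j _ => ?_)
  rw [Finset.mul_sum]
  refine (norm_sum_le _ _).trans (Finset.sum_le_sum fun n _ => ?_)
  rw [norm_mul]
  exact mul_le_mul_of_nonneg_right (norm_coeff_wpoly_le R n) (norm_nonneg _)

/-- **THE WINDOW CAUCHY–SCHWARZ**: for every density `g` on `T′` and every `b` on `T`,
`Σ_y ‖cWin·winSum g y‖·‖b y‖ ≤ (2/N)·√nsq(g)·√nsq(b)`. [folklore] -/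
theorem window_cs (μ : Fin d) (g : Tor (fine (R * N) M) → ℂ) (b : Tor (fine N M) → ℂ) :
    ∑ y, ‖cWin d N R * winSum N R M μ g y‖ * ‖b y‖ ≤ 2 / (N : ℝ) * (Real.sqrt (nsq g) * Real.sqrt (nsq b)) := by
  have hRpos : (0 : ℝ) < R := by exact_mod_cast Nat.pos_of_ne_zero (NeZero.ne R)
  have hNpos : (0 : ℝ) < N := by exact_mod_cast Nat.pos_of_ne_zero (NeZero.ne N)
  have hRd : (0 : ℝ) < (R : ℝ) ^ d := pow_pos hRpos d
  have hsq : 0 < Real.sqrt ((R : ℝ) ^ d) := Real.sqrt_pos.mpr hRd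
  set F : Finset (Fin d → Fin R) := univ.filter (fun j : Fin d → Fin R => (j μ : ℕ) = 0) with hF
  have h2 : ∑ y, ‖cWin d N R * winSum N R M μ g y‖ * ‖b y‖ ≤ ((N : ℝ) * Real.sqrt ((R : ℝ) ^ d))⁻¹ *
      ∑ y, ∑ j ∈ F, ∑ n ∈ range (2 * R - 2), ‖g (site N R M μ y j (n + 1))‖ * ‖b y‖ := by
    rw [Finset.mul_sum]
    refine Finset.sum_le_sum fun y _ => ?_
    calc ‖cWin d N R * winSum N R M μ g y‖ * ‖b y‖
        ≤ (((N : ℝ) * Real.sqrt ((R : ℝ) ^ d))⁻¹ * ∑ j ∈ F, ∑ n ∈ range (2 * R - 2), ‖g (site N R M μ y j (n + 1))‖) * ‖b y‖ :=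
          mul_le_mul_of_nonneg_right (norm_cWin_winSum_le N R M μ g y) (norm_nonneg _)
      _ = _ := by rw [mul_assoc, Finset.sum_mul]; congr 1; refine Finset.sum_congr rfl fun j _ => ?_; rw [Finset.sum_mul]
  have h3 : ∑ y, ∑ j ∈ F, ∑ n ∈ range (2 * R - 2), ‖g (site N R M μ y j (n + 1))‖ * ‖b y‖
      ≤ Real.sqrt (2 * nsq g) * Real.sqrt (2 * (R : ℝ) ^ d * nsq b) := by
    rw [← Finset.sum_product', ← Finset.sum_product']
    refine (Real.sum_mul_le_sqrt_mul_sqrt _ _ _).trans ?_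
    refine mul_le_mul (Real.sqrt_le_sqrt ?_) (Real.sqrt_le_sqrt ?_) (Real.sqrt_nonneg _) (Real.sqrt_nonneg _)
    · rw [Finset.sum_product, Finset.sum_product]
      have hw := sum_window_le N R M μ (g := fun x => ‖g x‖ ^ 2) (fun x => by positivity)
      rw [hF]
      exact hw
    · rw [Finset.sum_product, Finset.sum_product]
      simp only [Finset.sum_const, Finset.card_range, nsmul_eq_mul]
      rw [← Finset.mul_sum, ← Finset.mul_sum]
      have hcard := card_firstLayer_mul R (d := d) μ
      rw [← hF] at hcard
      have hR2 : ((2 * R - 2 : ℕ) : ℝ) ≤ 2 * R := by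
        have : 2 * R - 2 ≤ 2 * R := Nat.sub_le _ _
        exact_mod_cast this
      have hnsq : ∑ y, ‖b y‖ ^ 2 = nsq b := rfl
      rw [hnsq]
      calc (F.card : ℝ) * (((2 * R - 2 : ℕ) : ℝ) * nsq b) ≤ (F.card : ℝ) * ((2 * R) * nsq b) := by
            refine mul_le_mul_of_nonneg_left (mul_le_mul_of_nonneg_right hR2 (nsq_nonneg _)) (Nat.cast_nonneg _)
        _ = 2 * ((F.card : ℝ) * R) * nsq b := by ring
        _ = 2 * (R : ℝ) ^ d * nsq b := by rw [hcard]
  have h4 : ((N : ℝ) * Real.sqrt ((R : ℝ) ^ d))⁻¹ * (Real.sqrt (2 * nsq g) * Real.sqrt (2 * (R : ℝ) ^ d * nsq b))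
      = 2 / (N : ℝ) * (Real.sqrt (nsq g) * Real.sqrt (nsq b)) := by
    rw [Real.sqrt_mul (by norm_num : (0 : ℝ) ≤ 2) (nsq g), Real.sqrt_mul (by positivity : (0 : ℝ) ≤ 2 * (R : ℝ) ^ d) (nsq b),
      Real.sqrt_mul (by norm_num : (0 : ℝ) ≤ 2) ((R : ℝ) ^ d)]
    have h2s : Real.sqrt 2 * Real.sqrt 2 = 2 := Real.mul_self_sqrt (by norm_num)
    have hsN : Real.sqrt ((R : ℝ) ^ d) * ((N : ℝ) * Real.sqrt ((R : ℝ) ^ d))⁻¹ = (N : ℝ)⁻¹ := by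
      field_simp
    calc ((N : ℝ) * Real.sqrt ((R : ℝ) ^ d))⁻¹ * (Real.sqrt 2 * Real.sqrt (nsq g)
          * (Real.sqrt 2 * Real.sqrt ((R : ℝ) ^ d) * Real.sqrt (nsq b)))
        = (Real.sqrt 2 * Real.sqrt 2) * (Real.sqrt ((R : ℝ) ^ d) * ((N : ℝ) * Real.sqrt ((R : ℝ) ^ d))⁻¹)
          * (Real.sqrt (nsq g) * Real.sqrt (nsq b)) := by ring
      _ = 2 / (N : ℝ) * (Real.sqrt (nsq g) * Real.sqrt (nsq b)) := by rw [h2s, hsN, div_eq_mul_inv]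
  calc _ ≤ _ := h2
    _ ≤ ((N : ℝ) * Real.sqrt ((R : ℝ) ^ d))⁻¹ * (Real.sqrt (2 * nsq g) * Real.sqrt (2 * (R : ℝ) ^ d * nsq b)) :=
        mul_le_mul_of_nonneg_left h3 (by positivity)
    _ = _ := h4

/-! ## §3 The split of the window formula and the interior part -/

/-- the window formula of module M-P, read with `site` and `winSum`, split by `𝟙_{Ω′} + 𝟙_{¬Ω′}`. [folklore] -/
theorem Aop_sub_Fop_mulVec_split (μ : Fin d) (v : Tor (fine (R * N) M) → ℂ) (y : Tor (fine N M)) :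
    ((Aop N R M μ - Fop N R M μ) *ᵥ v) y
      = cWin d N R * winSum N R M μ
          (fun x => if refineR N R M Ω x then (Pdir (fine (R * N) M) ((R * N : ℕ) : ℂ) μ *ᵥ v) x else 0) y
        + cWin d N R * winSum N R M μ
          (fun x => if refineR N R M Ω x then 0 else (Pdir (fine (R * N) M) ((R * N : ℕ) : ℂ) μ *ᵥ v) x) y := by
  rw [Aop_sub_Fop_mulVec, ← mul_add, winSum, winSum, ← Finset.sum_add_distrib]
  congr 1
  refine Finset.sum_congr rfl fun j _ => ?_
  rw [← Finset.sum_add_distrib]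
  refine Finset.sum_congr rfl fun n _ => ?_
  rw [← mul_add, site]
  congr 1
  split_ifs <;> simp

/-- the interior density has `nsq ≤ H′_μ(v) := Σ_{x ∈ Ω′} |(∂′ᴴ∂′v)(x)|²` (equality in fact). [folklore] -/
theorem nsq_interior_density (μ : Fin d) (v : Tor (fine (R * N) M) → ℂ) :
    nsq (fun x => if refineR N R M Ω x then (Pdir (fine (R * N) M) ((R * N : ℕ) : ℂ) μ *ᵥ v) x else 0)
      = ∑ x ∈ univ.filter (refineR N R M Ω), ‖(Pdir (fine (R * N) M) ((R * N : ℕ) : ℂ) μ *ᵥ v) x‖ ^ 2 := by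
  rw [nsq, Finset.sum_filter]
  refine Finset.sum_congr rfl fun x _ => ?_
  split_ifs <;> simp

/-- **INTERIOR PART**: `Σ_y ‖cWin·winSum(𝟙_{Ω′}∂′ᴴ∂′v) y‖·‖b y‖ ≤ (2/N)·√H′_μ(v)·√nsq(b)`. [folklore] -/
theorem interior_le (μ : Fin d) (v : Tor (fine (R * N) M) → ℂ) (b : Tor (fine N M) → ℂ) :
    ∑ y, ‖cWin d N R * winSum N R M μ
        (fun x => if refineR N R M Ω x then (Pdir (fine (R * N) M) ((R * N : ℕ) : ℂ) μ *ᵥ v) x else 0) y‖ * ‖b y‖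
      ≤ 2 / (N : ℝ) * (Real.sqrt (∑ x ∈ univ.filter (refineR N R M Ω), ‖(Pdir (fine (R * N) M) ((R * N : ℕ) : ℂ) μ *ᵥ v) x‖ ^ 2)
          * Real.sqrt (nsq b)) := by
  rw [← nsq_interior_density N R M Ω μ v]
  exact window_cs N R M μ _ b

/-! ## §4 The exterior part: only boundary values pair -/

/-- if both cells of the face are inside `Ω`, the exterior density vanishes on the whole window. [folklore] -/
theorem winSum_exterior_eq_zero (μ : Fin d) (v : Tor (fine (R * N) M) → ℂ) {y : Tor (fine N M)} (hy : Ω y)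
    (hy' : Ω (y + unitVec (fine N M) μ)) :
    winSum N R M μ (fun x => if refineR N R M Ω x then 0 else (Pdir (fine (R * N) M) ((R * N : ℕ) : ℂ) μ *ᵥ v) x) y = 0 := by
  rw [winSum]
  refine Finset.sum_eq_zero fun j hj => Finset.sum_eq_zero fun n hn => ?_
  have hj' : (j μ : ℕ) = 0 := by simpa using hj
  have hn' := Finset.mem_range.mp hn
  rw [if_pos (refineR_site N R M Ω μ hy hy' hj' (by omega)), mul_zero]

/-- the BOUNDARY part of a coarse field `b` on `T`: kept only where exactly one of `y`, `y + e_μ` is in `Ω`. [folklore] -/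
def bdryPart (μ : Fin d) (b : Tor (fine N M) → ℂ) (y : Tor (fine N M)) : ℂ :=
  if (Ω y ↔ Ω (y + unitVec (fine N M) μ)) then 0 else b y

/-- **the exterior density pairs only with boundary differences**: for `u` vanishing off `Ω`,
`‖a_ext(y)‖·‖(∂_μu)(y)‖ = ‖a_ext(y)‖·‖bdryPart (∂_μu) y‖`. [folklore] -/
theorem exterior_pairs_bdry (μ : Fin d) (v : Tor (fine (R * N) M) → ℂ) {u : Tor (fine N M) → ℂ} (hu : ∀ y, ¬ Ω y → u y = 0)
    (y : Tor (fine N M)) :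
    ‖cWin d N R * winSum N R M μ (fun x => if refineR N R M Ω x then 0 else (Pdir (fine (R * N) M) ((R * N : ℕ) : ℂ) μ *ᵥ v) x) y‖
        * ‖(sdiff (fine N M) (N : ℂ) μ *ᵥ u) y‖
      = ‖cWin d N R * winSum N R M μ (fun x => if refineR N R M Ω x then 0 else (Pdir (fine (R * N) M) ((R * N : ℕ) : ℂ) μ *ᵥ v) x) y‖
        * ‖bdryPart N M Ω μ (sdiff (fine N M) (N : ℂ) μ *ᵥ u) y‖ := by
  rw [bdryPart]
  split_ifs with h
  · -- `Ω y ↔ Ω (y+e)`: both in (exterior density vanishes) or both out (`∂u(y) = 0`)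
    by_cases hy : Ω y
    · rw [winSum_exterior_eq_zero N R M Ω μ v hy (h.mp hy), mul_zero, norm_zero, zero_mul, zero_mul]
    · have hy' : ¬ Ω (y + unitVec (fine N M) μ) := fun h' => hy (h.mpr h')
      rw [sdiff_mulVec, hu _ hy, hu _ hy', sub_zero, mul_zero, norm_zero]
  · rfl

section Traces

variable (S : Tor M → Prop) [DecidablePred S]

/-- `nsq` of the boundary part of `∂_μu` for `u` vanishing off `Ω = blockReg N S`: the two summed coarse traces,
`≤ (4/N)·(‖∂_μu‖² + H_μ(u))`. [folklore] -/
theorem nsq_bdryPart_le (μ : Fin d) {u : Tor (fine N M) → ℂ} (hu : ∀ y, ¬ blockReg N M S y → u y = 0) :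
    nsq (bdryPart N M (blockReg N M S) μ (sdiff (fine N M) (N : ℂ) μ *ᵥ u))
      ≤ 4 / (N : ℝ) * (nsq (sdiff (fine N M) (N : ℂ) μ *ᵥ u)
          + ∑ x ∈ univ.filter (blockReg N M S), ‖(Pdir (fine N M) (N : ℂ) μ *ᵥ u) x‖ ^ 2) := by
  have hNpos : (0 : ℝ) < N := by exact_mod_cast Nat.pos_of_ne_zero (NeZero.ne N)
  have hf := trace_fwd_sum_le N M S μ u hu
  have hb := trace_bwd_sum_le N M S μ u hu
  set Ω := blockReg N M S with hΩ
  set e := unitVec (fine N M) μ with he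
  set T : Tor (fine N M) → ℝ := fun y => ‖(N : ℂ) * u y‖ ^ 2 with hT
  -- pointwise: `‖bdryPart (∂u) y‖² ≤ 𝟙[Ω y ∧ ¬Ω(y+e)]·T y + 𝟙[Ω(y+e) ∧ ¬Ω y]·T (y+e)`
  have hpt : ∀ y, ‖bdryPart N M Ω μ (sdiff (fine N M) (N : ℂ) μ *ᵥ u) y‖ ^ 2
      ≤ (if (Ω y ∧ ¬ Ω (y + e)) then T y else 0) + (if (Ω (y + e) ∧ ¬ Ω y) then T (y + e) else 0) := by
    intro y
    rw [bdryPart]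
    by_cases h1 : Ω y <;> by_cases h2 : Ω (y + e)
    · simp [h1, h2, ← he]
    · rw [if_neg (by tauto), if_pos ⟨h1, h2⟩, if_neg (by tauto), add_zero, hT, sdiff_mulVec, ← he, hu _ h2, zero_sub, mul_neg,
        norm_neg]
    · rw [if_neg (by tauto), if_neg (by tauto), if_pos ⟨h2, h1⟩, zero_add, hT, sdiff_mulVec, ← he, hu _ h1, sub_zero]
    · simp [h1, h2, ← he]
  have hA : ∑ y, (if (Ω y ∧ ¬ Ω (y + e)) then T y else 0) = ∑ y ∈ univ.filter (fun y => Ω y ∧ ¬ Ω (y + e)), T y :=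
    (Finset.sum_filter _ _).symm
  have hB : ∑ y, (if (Ω (y + e) ∧ ¬ Ω y) then T (y + e) else 0) = ∑ y ∈ univ.filter (fun y => Ω y ∧ ¬ Ω (y - e)), T y := by
    rw [Finset.sum_filter]
    exact Fintype.sum_equiv (Equiv.addRight e) _ _ (fun y => by simp only [Equiv.coe_addRight, add_sub_cancel_right])
  calc nsq (bdryPart N M Ω μ (sdiff (fine N M) (N : ℂ) μ *ᵥ u))
      ≤ ∑ y, ((if (Ω y ∧ ¬ Ω (y + e)) then T y else 0) + (if (Ω (y + e) ∧ ¬ Ω y) then T (y + e) else 0)) :=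
        Finset.sum_le_sum fun y _ => hpt y
    _ = ∑ y ∈ univ.filter (fun y => Ω y ∧ ¬ Ω (y + e)), T y + ∑ y ∈ univ.filter (fun y => Ω y ∧ ¬ Ω (y - e)), T y := by
        rw [Finset.sum_add_distrib, hA, hB]
    _ ≤ 2 / (N : ℝ) * (nsq (sdiff (fine N M) (N : ℂ) μ *ᵥ u) + ∑ x ∈ univ.filter Ω, ‖(Pdir (fine N M) (N : ℂ) μ *ᵥ u) x‖ ^ 2)
        + 2 / (N : ℝ) * (nsq (sdiff (fine N M) (N : ℂ) μ *ᵥ u) + ∑ x ∈ univ.filter Ω, ‖(Pdir (fine N M) (N : ℂ) μ *ᵥ u) x‖ ^ 2) :=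
        add_le_add hb hf
    _ = _ := by ring

/-- off `Ω′` the second difference of a field vanishing off `Ω′` carries only its neighbouring values:
`‖𝟙_{¬Ω′}(x)(∂′ᴴ∂′v)(x)‖² ≤ 2(RN)⁴·(𝟙_{¬Ω′}(x)‖v(x+e)‖² + 𝟙_{¬Ω′}(x)‖v(x−e)‖²)`. [folklore] -/
theorem normSq_exterior_density_le (μ : Fin d) {v : Tor (fine (R * N) M) → ℂ} (hv : ∀ x, ¬ blockReg (R * N) M S x → v x = 0)
    (x : Tor (fine (R * N) M)) :
    ‖(if blockReg (R * N) M S x then 0 else (Pdir (fine (R * N) M) ((R * N : ℕ) : ℂ) μ *ᵥ v) x)‖ ^ 2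
      ≤ 2 * ((R * N : ℕ) : ℝ) ^ 4 *
        ((if blockReg (R * N) M S x then 0 else ‖v (x + unitVec (fine (R * N) M) μ)‖ ^ 2)
          + (if blockReg (R * N) M S x then 0 else ‖v (x - unitVec (fine (R * N) M) μ)‖ ^ 2)) := by
  split_ifs with hx
  · simp
  · rw [Pdir_mulVec, hv _ hx, Complex.conj_natCast, mul_zero, zero_sub]
    have e : ‖(((R * N : ℕ) : ℂ)) * ((R * N : ℕ) : ℂ) *
        (-v (x + unitVec (fine (R * N) M) μ) - v (x - unitVec (fine (R * N) M) μ))‖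
        = ((R * N : ℕ) : ℝ) ^ 2 * ‖v (x + unitVec (fine (R * N) M) μ) + v (x - unitVec (fine (R * N) M) μ)‖ := by
      rw [norm_mul, norm_mul, Complex.norm_natCast, ← neg_add', norm_neg]; ring
    rw [e, mul_pow]
    have h := norm_add_le (v (x + unitVec (fine (R * N) M) μ)) (v (x - unitVec (fine (R * N) M) μ))
    have h0 := norm_nonneg (v (x + unitVec (fine (R * N) M) μ))
    have h1 := norm_nonneg (v (x - unitVec (fine (R * N) M) μ))
    have hc : (0 : ℝ) ≤ (((R * N : ℕ) : ℝ) ^ 2) ^ 2 := by positivity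
    nlinarith [mul_le_mul_of_nonneg_left (pow_le_pow_left₀ (norm_nonneg _) h 2) hc,
      sq_nonneg (‖v (x + unitVec (fine (R * N) M) μ)‖ - ‖v (x - unitVec (fine (R * N) M) μ)‖)]

/-- `nsq` of the exterior density for `v` vanishing off `Ω′ = blockReg (RN) S`: the two summed fine traces,
`≤ 8(RN)·(‖∂′_μv‖² + H′_μ(v))`. [folklore] -/
theorem nsq_exterior_density_le (μ : Fin d) {v : Tor (fine (R * N) M) → ℂ} (hv : ∀ x, ¬ blockReg (R * N) M S x → v x = 0) :
    nsq (fun x => if blockReg (R * N) M S x then 0 else (Pdir (fine (R * N) M) ((R * N : ℕ) : ℂ) μ *ᵥ v) x)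
      ≤ 8 * ((R * N : ℕ) : ℝ) * (nsq (sdiff (fine (R * N) M) ((R * N : ℕ) : ℂ) μ *ᵥ v)
          + ∑ x ∈ univ.filter (blockReg (R * N) M S), ‖(Pdir (fine (R * N) M) ((R * N : ℕ) : ℂ) μ *ᵥ v) x‖ ^ 2) := by
  have hc0 : (0 : ℝ) < ((R * N : ℕ) : ℝ) := by exact_mod_cast Nat.pos_of_ne_zero (NeZero.ne (R * N))
  have hf := trace_fwd_sum_le (R * N) M S μ v hv
  have hb := trace_bwd_sum_le (R * N) M S μ v hv
  have hpt := normSq_exterior_density_le N R M S μ hv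
  set Ω' := blockReg (R * N) M S with hΩ'
  set e := unitVec (fine (R * N) M) μ with he
  set c : ℝ := ((R * N : ℕ) : ℝ) with hc
  set T : Tor (fine (R * N) M) → ℝ := fun y => ‖(((R * N : ℕ) : ℂ)) * v y‖ ^ 2 with hT
  set X : ℝ := nsq (sdiff (fine (R * N) M) ((R * N : ℕ) : ℂ) μ *ᵥ v)
    + ∑ x ∈ univ.filter Ω', ‖(Pdir (fine (R * N) M) ((R * N : ℕ) : ℂ) μ *ᵥ v) x‖ ^ 2 with hX
  have hTv : ∀ y, ‖v y‖ ^ 2 = (c ^ 2)⁻¹ * T y := by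
    intro y
    show ‖v y‖ ^ 2 = (c ^ 2)⁻¹ * ‖(((R * N : ℕ) : ℂ)) * v y‖ ^ 2
    rw [norm_mul, Complex.norm_natCast, mul_pow, ← hc, ← mul_assoc, inv_mul_cancel₀ (by positivity), one_mul]
  -- the two shifted exterior sums are boundary sums of `v`
  have hF : ∑ x, (if Ω' x then (0 : ℝ) else ‖v (x + e)‖ ^ 2)
      = (c ^ 2)⁻¹ * ∑ y ∈ univ.filter (fun y => Ω' y ∧ ¬ Ω' (y - e)), T y := by
    rw [Finset.mul_sum, Finset.sum_filter]
    refine Fintype.sum_equiv (Equiv.addRight e) _ _ (fun x => ?_)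
    simp only [Equiv.coe_addRight, add_sub_cancel_right]
    by_cases hx : Ω' x
    · rw [if_pos hx, if_neg (fun h => h.2 hx)]
    · rw [if_neg hx]
      by_cases hxe : Ω' (x + e)
      · rw [if_pos ⟨hxe, hx⟩, hTv]
      · rw [if_neg (fun h => hxe h.1), hv _ hxe, norm_zero, zero_pow two_ne_zero]
  have hB : ∑ x, (if Ω' x then (0 : ℝ) else ‖v (x - e)‖ ^ 2)
      = (c ^ 2)⁻¹ * ∑ y ∈ univ.filter (fun y => Ω' y ∧ ¬ Ω' (y + e)), T y := by
    rw [Finset.mul_sum, Finset.sum_filter]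
    refine Fintype.sum_equiv (Equiv.subRight e) _ _ (fun x => ?_)
    simp only [Equiv.subRight_apply, sub_add_cancel]
    by_cases hx : Ω' x
    · rw [if_pos hx, if_neg (fun h => h.2 hx)]
    · rw [if_neg hx]
      by_cases hxe : Ω' (x - e)
      · rw [if_pos ⟨hxe, hx⟩, hTv]
      · rw [if_neg (fun h => hxe h.1), hv _ hxe, norm_zero, zero_pow two_ne_zero]
  have hsumF : ∑ y ∈ univ.filter (fun y => Ω' y ∧ ¬ Ω' (y - e)), T y ≤ 2 / c * X := hf
  have hsumB : ∑ y ∈ univ.filter (fun y => Ω' y ∧ ¬ Ω' (y + e)), T y ≤ 2 / c * X := hb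
  calc nsq (fun x => if Ω' x then 0 else (Pdir (fine (R * N) M) ((R * N : ℕ) : ℂ) μ *ᵥ v) x)
      ≤ ∑ x, 2 * c ^ 4 * ((if Ω' x then 0 else ‖v (x + e)‖ ^ 2) + (if Ω' x then 0 else ‖v (x - e)‖ ^ 2)) :=
        Finset.sum_le_sum fun x _ => hpt x
    _ = 2 * c ^ 4 * ((c ^ 2)⁻¹ * ∑ y ∈ univ.filter (fun y => Ω' y ∧ ¬ Ω' (y - e)), T y
          + (c ^ 2)⁻¹ * ∑ y ∈ univ.filter (fun y => Ω' y ∧ ¬ Ω' (y + e)), T y) := by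
        rw [← Finset.mul_sum, Finset.sum_add_distrib, hF, hB]
    _ ≤ 2 * c ^ 4 * ((c ^ 2)⁻¹ * (2 / c * X) + (c ^ 2)⁻¹ * (2 / c * X)) := by gcongr
    _ = 8 * c * X := by
        field_simp
        ring

end Traces

end Summit.QuantumFields.BalabanUV.Beta.GAN24.DirichletBoxTwoLevelCore

end
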